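import Summits.QuantumFields.YangMills.Theorems.UnitScaleTiltProp7CovKernelOfTransplant
import Summits.QuantumFields.YangMills.Theorems.UnitScaleTiltProp7PinnedKernelL1Rows
import HarnessLib

/-!
# Route `UnitScaleTilt`, crux K1 «MinimiserStabilityRegPr» (stmt-QuantumFields-19200), route-R E′ path (α′), (E1-b) at the CURVED background — (A-cov) MEMBER ROWS, part 1:
# (i) the T³ reading of the door ✓p677235 with the Agmon weight chosen PER BOND (`hKsup_of_transplant_T3'`: `∀ μ x, ∃ ω W₀, rows ∧ ∀ X, ∃ …` ⇒ the `hKsup` binder of ✓p675883 verbatim);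
# (ii) the weight package at a pole (✓ `exists_admissible_weight` + ✓ `sqrt_sum_inv_sq_le`: `hω₀ hω₁ hω₂ hW₀` in px4 g3's door letters with `a = 2κ∕ℓ`, `b = 4κ∕ℓ²`, `W₀` explicit, and `ω ≤ e^{κ(1 + R∕ℓ)}` on
# the `R`-ball) — the cone frame WITH the pole anchor is routeR-w4 g11's append `exists_coneFrame_rows_anchored_of_regPr` (same frame for `hpole` and `h1 h1' h2`), cited by name

Cell `ym3-torus`, width seat `ym3-torus-px22` (gen 3).  The member's Poincaré row `hP` is px4 g3's ✓ `Prop7CentrePinnedHessianPoincareCovMember.sqrt_sum_hs_le_of_regPr'` BY NAME (not restated).  THEOREMS ONLY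
(0 `def`, 0 `sorry`); `--supports stmt-QuantumFields-19200`, count-neutral.  YM₃ on T³ is a ladder rung (R3), not the Clay problem; nothing here claims the stub, the crux, d = 4 or the gap.

WHAT IS PROVED (ns `…Theorems.Prop7CovKernelMemberRows`).
* §1 ★★★ `hKsup_of_transplant_T3'` — as ✓ `hKsup_of_transplant_T3` but the weight `ω`, its count `W₀` and their four rows sit INSIDE `∀ μ x` (the door's `a b A` and the windows stay uniform).
* §2 ★★ `exists_weight_rows` — pole `x`, scale `ℓ ≥ 1`, rate `0 < κ ≤ 1`: `∃ ω`, `0 < ω`, steps `≤ (2κ∕ℓ)ω`, second differences `≤ (4κ∕ℓ²)ω`, `√Σω⁻² ≤ √((2(1 + (4κ∕(π√d·ℓ))⁻¹))^d)`, `ω z ≤ e^{κ(1 + tdist(z,x)∕ℓ)}`.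
HONEST SCOPE.  Plumbing; the last member file plugs gen-0 (✓p679067), the near datum (✓p679731), gen-1 (routeR-w6) and these rows into ✓ `htr_body_of_rows` and §1.

References: T. Bałaban, CMP 96 (1984) 223–250 [Balaban1984PropagatorsII] ((1.9) p.226, (2.61) p.234); CMP 99 (1985) 389–434 [Balaban1985BackgroundPropagators] ((3.3) p.390);
CMP 99 (1985) 75–102 [Balaban1985RegularSpaces] ((1.36) p.82); CMP 102 (1985) 277–309 [Balaban1985Variational] (Prop. 7 p.299).
-/

set_option autoImplicit false

noncomputable section

open scoped BigOperators Matrix.Norms.L2Operator Matrix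

namespace Summit.QuantumFields.YangMills.Theorems.Prop7CovKernelMemberRows

open Literature.MathematicalPhysics.QuantumFieldTheory.Balaban1983to89
open Literature.MathematicalPhysics.QuantumFieldTheory.Balaban1983to89.T3ContinuumYM3Torus
open B9Eq39Adjoint (R R_def covD covDstar divB)
open B9TorusCalculus (torusT torusT_apply torusT_symm_apply)
open B10Eq27TorusAxialLog (unitsField toUField)
open B15DeterminingSets (embIter)
open Summit.QuantumFields.YangMills.Theorems.Prop7CovHodgeSplit (unitsField_toUField_mem_unitary)
open Summit.QuantumFields.YangMills.Theorems.Prop7PinnedCovBiharmonicSolve (exists_pinned_covBilaplace_eq_off_T3)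
open Summit.QuantumFields.YangMills.Theorems.Prop7CovKernelOfTransplant (sqrt_hs_covD_interp_error_le_of_transplant)
open Summit.QuantumFields.YangMills.Theorems.Prop7TorusAgmonWeight (exists_admissible_weight)
open Summit.QuantumFields.YangMills.Theorems.Prop7PinnedKernelL1Rows (sqrt_sum_inv_sq_le)

/-! ## §1 ★★★ The door's T³ reading with the weight chosen per bond -/

/-- ★★★ **THE `hKsup` BINDER FROM TRANSPLANT DATA, WEIGHT PER BOND**: as ✓ `Prop7CovKernelOfTransplant.hKsup_of_transplant_T3`, but `ω`, `W₀` and the rows `hω₀ hω₁ hω₂ hW₀` are supplied for each bond `(x, μ)`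
(the Agmon weight is centred at the pole `x`); `a b A`, the windows and `κ` stay uniform. [cite: Balaban1985Variational, Prop. 7 p.299; Balaban1985RegularSpaces, (1.36) p.82; Balaban1985BackgroundPropagators, (3.3) p.390] -/
theorem hKsup_of_transplant_T3' (F : T3Family) (K n : ℕ) (W : GaugeField (F.P K) 0 (Matrix.specialUnitaryGroup (Fin 2) ℂ))
    {a b A : ℝ} (ha0 : 0 ≤ a) (hb0 : 0 ≤ b) (hA : 0 ≤ A)
    (hP : ∀ v : Site (F.P K) 0 → Matrix (Fin 2) (Fin 2) ℂ, (∀ y ∈ Set.range (embIter (K - n)), v y = 0) →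
      Real.sqrt (∑ x, ∑ j : Fin 2, ∑ k : Fin 2, ‖(v x) j k‖ ^ 2)
        ≤ A * Real.sqrt (∑ x, ∑ j : Fin 2, ∑ k : Fin 2, ‖(divB (torusT (F.P K) 0) (fun κ z => unitsField (toUField W) ⟨z, κ⟩)
          (fun μ => covD (torusT (F.P K) 0) (fun κ z => unitsField (toUField W) ⟨z, κ⟩) μ v) x) j k‖ ^ 2))
    (ha : a ≤ 1 / 2) (hwin₁ : a * Real.sqrt (F.P K).d * Real.sqrt A ≤ 1 / 100) (hwin₂ : b * (F.P K).d * A ≤ 1 / 50)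
    {κ : ℝ} (hκ : 0 ≤ κ)
    (htr : ∀ (μ : Fin (F.P K).d) (x : Site (F.P K) 0), ∃ (ω : Site (F.P K) 0 → ℝ) (W₀ : ℝ),
      (∀ z, 0 < ω z) ∧
      (∀ z ν, |ω (z.shift ν) - ω z| ≤ a * ω z ∧ |ω (z.unshift ν) - ω z| ≤ a * ω z) ∧
      (∀ z ν, |ω (z.shift ν) + ω (z.unshift ν) - 2 * ω z| ≤ b * ω z) ∧
      Real.sqrt (∑ z, (ω z)⁻¹ ^ 2) ≤ W₀ ∧
      ∀ X : Matrix (Fin 2) (Fin 2) ℂ,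
      ∃ (V h s : Site (F.P K) 0 → Matrix (Fin 2) (Fin 2) ℂ) (χ : Site (F.P K) 0 → ℝ) (u : Site (F.P K) 0 → Matrix (Fin 2) (Fin 2) ℂ) (Nh N₂ N₃ N₄ H S : ℝ),
      (∀ z ∉ Set.range (embIter (K - n)), divB (torusT (F.P K) 0) (fun κ z => unitsField (toUField W) ⟨z, κ⟩)
          (fun κ' => covD (torusT (F.P K) 0) (fun κ z => unitsField (toUField W) ⟨z, κ⟩) κ'
            (fun y => divB (torusT (F.P K) 0) (fun κ z => unitsField (toUField W) ⟨z, κ⟩)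
              (fun ν => covD (torusT (F.P K) 0) (fun κ z => unitsField (toUField W) ⟨z, κ⟩) ν V) y)) z
          = ((if z = torusT (F.P K) 0 μ x then R (unitsField (toUField W) ⟨x, μ⟩)⁻¹ X else 0) - (if z = x then X else 0))
            + (divB (torusT (F.P K) 0) (fun κ z => unitsField (toUField W) ⟨z, κ⟩)
                (fun κ' => covD (torusT (F.P K) 0) (fun κ z => unitsField (toUField W) ⟨z, κ⟩) κ' h) z + s z)) ∧
      (∀ y ∈ Set.range (embIter (K - n)), u y = χ y • V y) ∧
      Real.sqrt (∑ z, ω z ^ 2 * ∑ j : Fin 2, ∑ k : Fin 2, ‖(divB (torusT (F.P K) 0) (fun κ z => unitsField (toUField W) ⟨z, κ⟩)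
        (fun κ' => covD (torusT (F.P K) 0) (fun κ z => unitsField (toUField W) ⟨z, κ⟩) κ' (fun y => (1 - χ y) • V y)) z) j k‖ ^ 2) ≤ Nh ∧
      ∑ z, Real.sqrt (∑ j : Fin 2, ∑ k : Fin 2, ‖(divB (torusT (F.P K) 0) (fun κ z => unitsField (toUField W) ⟨z, κ⟩)
        (fun κ' => covD (torusT (F.P K) 0) (fun κ z => unitsField (toUField W) ⟨z, κ⟩) κ' (fun y => χ y • V y)) z) j k‖ ^ 2) ≤ N₂ ∧
      ∑ z, Real.sqrt (∑ j : Fin 2, ∑ k : Fin 2, ‖(divB (torusT (F.P K) 0) (fun κ z => unitsField (toUField W) ⟨z, κ⟩)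
        (fun κ' => covD (torusT (F.P K) 0) (fun κ z => unitsField (toUField W) ⟨z, κ⟩) κ' u) z) j k‖ ^ 2) ≤ N₃ ∧
      Real.sqrt (∑ z, ω z ^ 2 * ∑ j : Fin 2, ∑ k : Fin 2, ‖(divB (torusT (F.P K) 0) (fun κ z => unitsField (toUField W) ⟨z, κ⟩)
        (fun κ' => covD (torusT (F.P K) 0) (fun κ z => unitsField (toUField W) ⟨z, κ⟩) κ' u) z) j k‖ ^ 2) ≤ N₄ ∧
      Real.sqrt (∑ z, ω z ^ 2 * ∑ j : Fin 2, ∑ k : Fin 2, ‖(h z) j k‖ ^ 2) ≤ H ∧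
      Real.sqrt (∑ z, ω z ^ 2 * ∑ j : Fin 2, ∑ k : Fin 2, ‖(s z) j k‖ ^ 2) ≤ S ∧
      W₀ * (3 * Nh) + N₂ + N₃ + W₀ * (3 * N₄) + W₀ * (3 * H + 5 * A * S) ≤ κ * Real.sqrt (∑ j : Fin 2, ∑ k : Fin 2, ‖X j k‖ ^ 2)) :
    ∀ (φ φH : Site (F.P K) 0 → Matrix (Fin 2) (Fin 2) ℂ),
      (∀ y : Site (F.P K) (K - n), φH (embIter (K - n) y) = φ (embIter (K - n) y)) →
      (∀ x : Site (F.P K) 0, x ∉ Set.range (embIter (K - n)) →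
        divB (torusT (F.P K) 0) (fun κ z => unitsField (toUField W) ⟨z, κ⟩)
          (fun μ => covD (torusT (F.P K) 0) (fun κ z => unitsField (toUField W) ⟨z, κ⟩) μ
            (fun y => divB (torusT (F.P K) 0) (fun κ z => unitsField (toUField W) ⟨z, κ⟩)
              (fun ν => covD (torusT (F.P K) 0) (fun κ z => unitsField (toUField W) ⟨z, κ⟩) ν φH) y)) x = 0) →
      ∀ s₁ : ℝ, (∀ z, Real.sqrt (∑ j : Fin 2, ∑ k : Fin 2,
        ‖(divB (torusT (F.P K) 0) (fun κ z => unitsField (toUField W) ⟨z, κ⟩)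
          (fun μ => covD (torusT (F.P K) 0) (fun κ z => unitsField (toUField W) ⟨z, κ⟩) μ φ) z) j k‖ ^ 2) ≤ s₁) →
      ∀ (μ : Fin (F.P K).d) (x : Site (F.P K) 0),
        Real.sqrt (∑ j : Fin 2, ∑ k : Fin 2, ‖(covD (torusT (F.P K) 0) (fun κ z => unitsField (toUField W) ⟨z, κ⟩) μ (fun y => φ y - φH y) x) j k‖ ^ 2) ≤ κ * s₁ := by
  intro φ φH hH hEL s₁ hs₁ μ x
  have hU := fun κ (z : Site (F.P K) 0) => unitsField_toUField_mem_unitary W κ z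
  have hsolve : ∀ g : Site (F.P K) 0 → Matrix (Fin 2) (Fin 2) ℂ, ∃ q : Site (F.P K) 0 → Matrix (Fin 2) (Fin 2) ℂ,
      (∀ y ∈ Set.range (embIter (K - n)), q y = 0) ∧
      ∀ z ∉ Set.range (embIter (K - n)), divB (torusT (F.P K) 0) (fun κ z => unitsField (toUField W) ⟨z, κ⟩)
        (fun μ => covD (torusT (F.P K) 0) (fun κ z => unitsField (toUField W) ⟨z, κ⟩) μ
          (fun y => divB (torusT (F.P K) 0) (fun κ z => unitsField (toUField W) ⟨z, κ⟩)
            (fun ν => covD (torusT (F.P K) 0) (fun κ z => unitsField (toUField W) ⟨z, κ⟩) ν q) y)) z = g z := by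
    intro g
    obtain ⟨q, hq0, hq⟩ := exists_pinned_covBilaplace_eq_off_T3 F K (K - n) W g
    refine ⟨q, ?_, hq⟩
    rintro y ⟨y', rfl⟩
    exact hq0 y'
  have hH' : ∀ y ∈ Set.range (embIter (K - n)), φH y = φ y := by
    rintro y ⟨y', rfl⟩
    exact hH y'
  obtain ⟨ω, W₀, hω₀, hω₁, hω₂, hW₀, htrX⟩ := htr μ x
  exact sqrt_hs_covD_interp_error_le_of_transplant hU (Set.range (embIter (K - n))) hsolve ω ha0 hb0 hA hω₀ hω₁ hω₂ hP ha hwin₁ hwin₂ hW₀ μ x hκ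
    htrX φ φH hH' hEL hs₁

/-! ## §2 ★★ The weight package at a pole -/

/-- ★★ **THE AGMON WEIGHT AT A POLE WITH ALL DOOR ROWS AND ITS SIZE ON BALLS**: scale `ℓ ≥ 1`, rate `0 < κ ≤ 1`, pole `x`: `∃ ω > 0` with px4 g3's regularity rows at `a := 2κ∕ℓ`, `b := 4κ∕ℓ²`, the count
`√Σω⁻² ≤ √((2(1 + (4κ∕(π√d·ℓ))⁻¹))^d)`, and `ω z ≤ e^{κ(1 + tdist(z,x)∕ℓ)}` (✓ `exists_admissible_weight` + ✓ `sqrt_sum_inv_sq_le`). [cite: Balaban1984PropagatorsII, (1.9) p.226, (2.61) p.234] -/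
theorem exists_weight_rows {P : Params} {j : ℕ} (x : Site P j) {ℓ κ : ℝ} (hℓ : 1 ≤ ℓ) (hκ0 : 0 < κ) (hκ1 : κ ≤ 1) :
    ∃ ω : Site P j → ℝ,
      (∀ z, 0 < ω z) ∧
      (∀ z ν, |ω (z.shift ν) - ω z| ≤ (2 * κ / ℓ) * ω z ∧ |ω (z.unshift ν) - ω z| ≤ (2 * κ / ℓ) * ω z) ∧
      (∀ z ν, |ω (z.shift ν) + ω (z.unshift ν) - 2 * ω z| ≤ (4 * κ / ℓ ^ 2) * ω z) ∧
      Real.sqrt (∑ z, (ω z)⁻¹ ^ 2) ≤ Real.sqrt ((2 * (1 + 1 / (4 * κ / (Real.pi * Real.sqrt P.d * ℓ)))) ^ P.d) ∧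
      (∀ z, ω z ≤ Real.exp (κ * (1 + (Site.tdist z x : ℝ) / ℓ))) := by
  obtain ⟨ω, hω₀, hω₁, hω₂, hlo, hhi⟩ := exists_admissible_weight (P := P) (j := j) x hℓ hκ0.le hκ1
  exact ⟨ω, hω₀, hω₁, hω₂, sqrt_sum_inv_sq_le x ω hκ0 (by linarith) hlo, hhi⟩



end Summit.QuantumFields.YangMills.Theorems.Prop7CovKernelMemberRows

end
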